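import Mathlib.NumberTheory.Padics.HeightOneSpectrum
import Mathlib.Analysis.Complex.Basic
import Literature.NumberTheory.GaloisRepresentations.GaloisRep
import HarnessLib

/-!
# Deligne–Serre 1974, Lemme 3.2: complex Galois representations are determined by Frobenius

Deligne–Serre, *Formes modulaires de poids 1*, Ann. Sci. ÉNS (4) 7 (1974), §3, Lemme 3.2 with
Rem. 3.3–3.4, vendored as a named fact (D-0014) in the case `k = ℂ` and for representations
unramified outside a finite set of primes (the form in which it is used in op. cit., Rem. 4.3
— uniqueness of the representation attached to a weight-one form — and §8.6):

* `Literature.NumberTheory.GaloisRepresentations.DeligneSerre1974.lemma32_complex` — two semisimple continuous representations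
  `ρ, ρ' : Gal(ℚ̄/ℚ) → GL_n(ℂ)` with finite image which, at every prime `p` outside a finite
  set `S`, are unramified with the same characteristic polynomial of Frobenius, are isomorphic.

The printed lemma is more general (any set `X` of primes of density `1`; coefficients `ℂ`,
a finite extension of `ℚ_ℓ`, or a finite field; in characteristic `0` equality of traces
suffices) and rests on the Chebotarev density theorem together with the fact that a semisimple
representation is determined by its characteristic polynomials (Curtis–Reiner §30.16 =
Brauer–Nesbitt); Mathlib has no Chebotarev density theorem, hence a named fact. The version
below is implied by the printed one: a cofinite set of primes has density `1` (Rem. 3.3), equal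
characteristic polynomials have equal traces, and a continuous representation with finite image
is continuous for the discrete topology of `ℂ` (§3 (a)).

## Design notes

* Vocabulary from `Literature.NumberTheory.GaloisRepresentations.GaloisRep` (trunk GalRep):
  `Literature.FramedGaloisRep ℚ ℂ n`, `FramedGaloisRep.IsUnramifiedAt`, `FramedGaloisRep.HasFrobCharpolyAt`
  (arithmetic Frobenius, all primes of `\bar ℤ` above `p`), `ContinuousRep.IsSemisimple`,
  `ContinuousRep.Equiv`; rational primes are `HeightOneSpectrum (𝓞 ℚ)` matched with `ℕ` by
  Mathlib's `Rat.HeightOneSpectrum.primesEquiv`, as in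
  `Literature.NumberTheory.EllipticCurves.NewformGaloisRep`.
* Semisimplicity is automatic over `ℂ` for finite image (Rem. 3.4, Maschke) but is kept as a
  hypothesis, as printed in Lemme 3.2.

## References

* P. Deligne, J.-P. Serre, *Formes modulaires de poids 1*, Ann. Sci. ÉNS (4) 7 (1974), 507–530,
  §3, Lemme 3.2 and Rem. 3.3–3.4 (p. 513).
-/

noncomputable section

open scoped NumberField

open IsDedekindDomain Rat.HeightOneSpectrum

namespace Literature.NumberTheory.GaloisRepresentations.DeligneSerre1974

/-- **Deligne–Serre 1974, Lemme 3.2** (with Rem. 3.3–3.4; case `k = ℂ`, unramified outside a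
finite set). Let `ρ, ρ' : Gal(ℚ̄/ℚ) → GL_n(ℂ)` be two semisimple continuous representations with
finite image and `S` a finite set of primes such that for every prime `p ∉ S`, `ρ` and `ρ'` are
unramified at `p` and the arithmetic Frobenii at `p` have the same characteristic polynomial
under `ρ` and `ρ'` (`P_{p,ρ}(T) = P_{p,ρ'}(T)`). Then `ρ` and `ρ'` are isomorphic. (Chebotarev's
density theorem plus Brauer–Nesbitt / Curtis–Reiner §30.16.)
[cite: DeligneSerreASENS1974, Lemme 3.2 and Rem. 3.3] -/
def lemma32_complex : Prop :=
  ∀ ⦃n : ℕ⦄ (S : Finset ℕ) (ρ ρ' : FramedGaloisRep ℚ ℂ n),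
    (Set.range ρ).Finite → (Set.range ρ').Finite →
    ρ.toGaloisRep.IsSemisimple → ρ'.toGaloisRep.IsSemisimple →
    (∀ v : HeightOneSpectrum (𝓞 ℚ), ((primesEquiv v : Nat.Primes) : ℕ) ∉ S →
      ρ.IsUnramifiedAt v ∧ ρ'.IsUnramifiedAt v ∧
        ∃ P : Polynomial ℂ, ρ.HasFrobCharpolyAt v P ∧ ρ'.HasFrobCharpolyAt v P) →
    Nonempty (ContinuousRep.Equiv ρ.toGaloisRep ρ'.toGaloisRep)

/-- Lemme 3.2 with the exceptional primes given as a finite `Set` (e.g. `{p ∣ N}`, `N ≠ 0`,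
as in `Literature.NumberTheory.EllipticCurves.NewformGaloisRep`). [folklore] -/
lemma lemma32_complex.of_finite (h : lemma32_complex) {n : ℕ} {S : Set ℕ} (hS : S.Finite)
    (ρ ρ' : FramedGaloisRep ℚ ℂ n) (hρ : (Set.range ρ).Finite) (hρ' : (Set.range ρ').Finite)
    (hs : ρ.toGaloisRep.IsSemisimple) (hs' : ρ'.toGaloisRep.IsSemisimple)
    (hST : ∀ v : HeightOneSpectrum (𝓞 ℚ), ((primesEquiv v : Nat.Primes) : ℕ) ∉ S →
      ρ.IsUnramifiedAt v ∧ ρ'.IsUnramifiedAt v ∧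
        ∃ P : Polynomial ℂ, ρ.HasFrobCharpolyAt v P ∧ ρ'.HasFrobCharpolyAt v P) :
    Nonempty (ContinuousRep.Equiv ρ.toGaloisRep ρ'.toGaloisRep) :=
  h hS.toFinset ρ ρ' hρ hρ' hs hs' fun v hv ↦ hST v (by simpa using hv)

end Literature.NumberTheory.GaloisRepresentations.DeligneSerre1974
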